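import Mathlib
import HarnessLib
import Literature.Computability.AlgebraicComplexity.NewtonPolygonTauProofs
import Summits.ValiantsHypothesis.ValiantsHypothesis.Theses.NewtonFrames
import Summits.ValiantsHypothesis.ValiantsHypothesis.Theorems.NewtonFramesNewtonTauWeakSlopeLadderBlocking
import Summits.ValiantsHypothesis.ValiantsHypothesis.Theorems.NewtonFramesNewtonTauWeakBlockConvexFarey
import Summits.ValiantsHypothesis.ValiantsHypothesis.Theorems.NewtonFramesCappedSlopeSum
import Summits.ValiantsHypothesis.ValiantsHypothesis.Theorems.NewtonFramesBlockConvexBoundOfThreeSetBound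

/-!
# Line `landing-collapse` — crux `NewtonTauWeak` (stmt-ValiantsHypothesis-5904), lens = nearmiss (val-idea-12, D-0145/D-0148)

BEARS ON the rung `BeatTwoThirds` of the line of record `Lines/slope_ladder.lean` (`∃ c < 2/3, SlopeBound c`; FRONTIER
disposition: convex geometry, not a step toward VP ≠ VNP), through its OPEN stub `BlockConvexBound` (the `M_r(N)` problem of
[BBFKOTT10 §5] for some `r ≥ 4`) and the LANDED `SlopeLadderBlocking.stub_blocking` (p578760).

THE MEASURED NEAR-MISS (census v4.1 §1/§5-Q6, `BlockConvexFarey`, p593702).  Every `r = 4` configuration is an incidence structure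
between the sumset `P₁ + P₂` (≤ N² points) and the `≤ N²` translates `−y + Γ`, `y ∈ P₃ + P₄`, of the hull curve `Γ`; the ONLY upper-bound
input in play, the Eisenbrand–Pach–Rothvoß–Sopher / Szemerédi–Trotter step (`EPRS.card_le_of_lower_support`), treats `P₁ + P₂` as an
ARBITRARY `N²`-set and gives `N^{8/3}`; the best structure-respecting configuration (Farey–parabola, `farey_parabola_main`: sizes
`n, n, n²`) gives exactly `n^{7/3}/8`, and all 22 census families with a genuine fourth summand die at `N²`.  Measured exponent deficit
at the benchmark `(n, n, n²)`: `7/3` (constructions) versus `8/3` (incidence bound).  THE SINGLE INPUT TO IMPROVE: an incidence bound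
that SEES the sumset structure of the point side.

THE LEVER — LANDING COLLAPSE.  In the Farey analysis (`BlockConvexFarey`, module doc) the sumset `P₁ + P₂` becomes the GRID `[n]²`, the
translates of `Γ` become LINES, and the convexly independent output is the set of distinct LANDINGS (abscissa + slope data), which is
injective in the SLOPE and capped at `n` per slope (one landing per column).  Counting rich lines through a grid BY SLOPE HEIGHT
(`a/b` of height `h` saturates its cap only with `≍ h` parallel lines; `Σ_{h ≤ H} h² ≍ H³ ≤ n²` forces `H ≤ n^{2/3}`) caps every such
family at `n · H² = n^{7/3}` — the rung `stub_cappedSlopeSumRung` (LANDED p601033 `Theorems/NewtonFramesCappedSlopeSum.lean`, `C = 5`,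
val-width-5904-lc1; tight by `farey_parabola_main`).  The line's thesis
`ThreeSetBound` is that this collapse is GENERAL: a convexly independent subset of `P₁ + P₂ + Y` (`#P₁, #P₂ ≤ n`, `#Y ≤ n²`) has
`≤ C (n+2)^{8/3 − η}` points for some `η > 0` ("sumsets are never EPRS-extremal").  Attack = the Szemerédi–Trotter dichotomy behind
EPRS: near-extremality forces `≍ n^{4/3}` translates to be `≍ n^{4/3}`-rich on the `n²`-set `P₁ + P₂`, i.e. (Sheffer–Silier,
arXiv:2110.09692, Thm 1.3–1.5 and the open question after Thm 1.5) a Cartesian-product-like structure with `Θ(n^{1/3})` families of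
`Θ(n^{2/3})` parallel rich "lines" — exactly the grid regime where the slope-height count bites.  `benchmarkTransfer` (PROVED in this file,
S) turns `ThreeSetBound` into `BlockConvexBound` with `r = 4`, `δ = η/4` (`Y := P₃ + P₄`), and the landed `stub_blocking` gives the rung.

STATUS (rev 3, 2026-08-28): sorries 2 = `stub_threeSetBound` (the crux of the line, a LAW: 0 provers) + `stub_residualSlope` (declared residual);
`stub_cappedSlopeSumRung` and U2 `benchmarkTransfer` are discharged (the former BY NAME from p601033, the latter proved here and landed as p600179).

VP ≠ VNP is NOT moved: the rung is FRONTIER-disposition convex geometry two residuals below the crux; the crux `NewtonTauWeak` is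
reached only through the declared residual `ResidualSlope` (verbatim `SlopeLadder.ResidualSlope`), never staffed.

Disproof used / dead lines honoured: no ALIGNED PEELING (`Negative.AlignedPeelingCex.not_exists_alignedPeeling`: the line never peels
summands, it bounds a 3-fold configuration GLOBALLY); no bound shape beyond `SlopeBound c` (Root/Quasi/Subexp shapes are
summit-strength); no regime restriction on `(k, m, t)`; `r ≤ 3` is avoided (`M_2 = Θ(N^{4/3})`, `M_3 = Θ(N²)` give slope exactly
`2/3`; `BlockConvexCeiling.stub_witness_delta_le`: any witness has `δ ≤ 1/6`, and `η ≤ 2/3` here is consistent with it: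
`δ = η/4 ≤ 1/6`).
-/

noncomputable section

open scoped BigOperators Pointwise
open MvPolynomial
open Literature.Computability.AlgebraicComplexity (newtonVertexCount)

-- `Summit.ValiantsHypothesis.ValiantsHypothesis.…` is the tree's single-conjunct layout (Sub = Summit).
set_option linter.dupNamespace false

namespace Summit.ValiantsHypothesis.ValiantsHypothesis.Cruxes.NewtonTauWeak.LandingCollapse

/-! ### Statements (verbatim copies of the line of record where they coincide) -/

/-- `SlopeBound c` — verbatim `SlopeLadder.SlopeBound`. [cite: KoiranPortierTavenasThomasse2015, Theorem 6] -/
def SlopeBound (c : ℝ) : Prop :=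
  ∃ (C : ℝ) (b : ℕ), ∀ (k m t : ℕ) (f : Fin k → Fin m → MvPolynomial (Fin 2) ℂ),
    (∀ i j, (f i j).support.card ≤ t) →
      (newtonVertexCount (∑ i, ∏ j, f i j) : ℝ) ≤
        C * ((k : ℝ) + 2) ^ b * 2 ^ (b * m) * ((t : ℝ) + 2) ^ b * ((t : ℝ) + 2) ^ (c * (m : ℝ))

/-- The rung `BeatTwoThirds` — verbatim `SlopeLadder.BeatTwoThirds`. [folklore] -/
def BeatTwoThirds : Prop := ∃ c : ℝ, c < 2 / 3 ∧ SlopeBound c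

/-- `BlockConvexBound` — verbatim `SlopeLadder.BlockConvexBound` (= the hypothesis of the landed `SlopeLadderBlocking.stub_blocking`).
[cite: BBFKOTT10, §5; EisenbrandPachRothvossSopher2008, Thm 1] -/
def BlockConvexBound : Prop :=
  ∃ (r : ℕ) (δ C : ℝ), 2 ≤ r ∧ 0 < δ ∧
    ∀ (N : ℕ) (P : Fin r → Finset (Fin 2 → ℝ)) (S : Finset (Fin 2 → ℝ)),
      (∀ i, (P i).card ≤ N) → S ⊆ ∑ i, P i →
        ConvexIndependent ℝ (Subtype.val : ↥(S : Set (Fin 2 → ℝ)) → (Fin 2 → ℝ)) →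
          (S.card : ℝ) ≤ C * ((N : ℝ) + 2) ^ ((2 / 3 - δ) * (r : ℝ))

/-- **THE LINE'S CRUX `ThreeSetBound` — SUMSETS ARE NOT EPRS-EXTREMAL.**  For some `η > 0`: a convexly independent subset of
`P₁ + P₂ + Y` with `#P₁, #P₂ ≤ n` and `#Y ≤ n²` has at most `C (n+2)^{8/3 − η}` points.  (EPRS gives `8/3`; the Farey–parabola
configuration `BlockConvexFarey.farey_parabola_main` gives `7/3`; the conjectured truth is `7/3`, any `η > 0` suffices here.)
[cite: EisenbrandPachRothvossSopher2008, Thm 1; ShefferSilier2021 (arXiv:2110.09692), Thm 1.3–1.5] -/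
def ThreeSetBound : Prop :=
  ∃ (η C : ℝ), 0 < η ∧
    ∀ (n : ℕ) (P₁ P₂ Y S : Finset (Fin 2 → ℝ)),
      P₁.card ≤ n → P₂.card ≤ n → Y.card ≤ n ^ 2 → S ⊆ P₁ + P₂ + Y →
        ConvexIndependent ℝ (Subtype.val : ↥(S : Set (Fin 2 → ℝ)) → (Fin 2 → ℝ)) →
          (S.card : ℝ) ≤ C * ((n : ℝ) + 2) ^ ((8 : ℝ) / 3 - η)

open Classical in
/-- **THE RUNG `CappedSlopeSum` (landing collapse on the grid).**  For `≤ n²` non-vertical real lines `y = s·x + c` (`(s, c) ∈ Λ`), the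
number of LANDINGS — pairs (slope, covered point of the grid `[n]²`), capped at `n` per slope — is `≤ C (n+2)^{7/3}`.  In the
coordinates `(x, y − x²)` this is exactly the count of convex-position points produced by the Farey–parabola mechanism, so
`farey_parabola_main` shows the exponent `7/3` is attained. [cite: BBFKOTT10, §5; SzekelyCrossing1997, Thm 2] -/
def CappedSlopeSum : Prop :=
  ∃ C : ℝ, ∀ (n : ℕ) (Λ : Finset (ℝ × ℝ)), Λ.card ≤ n ^ 2 →
    (∑ s ∈ Λ.image Prod.fst,
        (min n (((Finset.range n) ×ˢ (Finset.range n)).filter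
          (fun x : ℕ × ℕ => ∃ l ∈ Λ, l.1 = s ∧ (x.2 : ℝ) = s * (x.1 : ℝ) + l.2)).card : ℝ)) ≤
      C * ((n : ℝ) + 2) ^ ((7 : ℝ) / 3)

/-- **DECLARED RESIDUAL** — verbatim `SlopeLadder.ResidualSlope` (the gap implication rung ⇒ crux; never staffed). [folklore] -/
def ResidualSlope : Prop := BeatTwoThirds → Summit.ValiantsHypothesis.ValiantsHypothesis.Theses.NewtonFrames.NewtonTauWeak

/-! ### Registered obligations (sorries live only here) -/

/-- **U1 — THE CRUX OF THE LINE** (OPEN; the single input that improves the measured exponent): `ThreeSetBound`.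
Why it might fail: a sumset `P₁ + P₂` projectively equivalent to the BBFKOTT extremal `N²`-set would give `8/3`; the census's
transplant of that set is NOT a sumset (projective maps destroy additivity), and no sumset family beats `7/3`.
[cite: EisenbrandPachRothvossSopher2008, Thm 1; BBFKOTT10, §5; ShefferSilier2021, Thm 1.5] -/
theorem stub_threeSetBound : ThreeSetBound := by
  sorry

/-- **U2 — BENCHMARK TRANSFER** (PROVED here, size S; also LANDED as `Theorems.NewtonFramesNewtonTauWeak.LandingCollapse.blockConvexBound_of_threeSetBound`,
p600179, see `benchmarkTransfer'` below): `ThreeSetBound → BlockConvexBound` with `r = 4`, `δ = η/4`, grouping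
`Y := P 2 + P 3` (`#Y ≤ N²`, `Finset.card_add_le`; `∑_{i<4} P i = P 0 + P 1 + (P 2 + P 3)`, `Fin.sum_univ_four`;
`(2/3 − η/4)·4 = 8/3 − η`). [folklore] -/
theorem benchmarkTransfer : ThreeSetBound → BlockConvexBound := by
  classical
  rintro ⟨η, C, hη, h⟩
  refine ⟨4, η / 4, C, by norm_num, by positivity, ?_⟩
  intro N P S hP hS hconv
  have hY : (P 2 + P 3).card ≤ N ^ 2 := by
    calc (P 2 + P 3).card ≤ (P 2).card * (P 3).card := Finset.card_add_le
      _ ≤ N * N := Nat.mul_le_mul (hP 2) (hP 3)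
      _ = N ^ 2 := (sq N).symm
  have hsum : ∑ i, P i = P 0 + P 1 + (P 2 + P 3) := by
    rw [Fin.sum_univ_four, add_assoc]
  have hS' : S ⊆ P 0 + P 1 + (P 2 + P 3) := hsum ▸ hS
  have hmain := h N (P 0) (P 1) (P 2 + P 3) S (hP 0) (hP 1) hY hS' hconv
  have hexp : ((2 : ℝ) / 3 - η / 4) * ((4 : ℕ) : ℝ) = (8 : ℝ) / 3 - η := by push_cast; ring
  rw [hexp]
  exact hmain

/-- U2 through the LANDED Theorems file (p600179), by name. -/
theorem benchmarkTransfer' : ThreeSetBound → BlockConvexBound :=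
  Summit.ValiantsHypothesis.ValiantsHypothesis.Theorems.NewtonFramesNewtonTauWeak.LandingCollapse.blockConvexBound_of_threeSetBound

/-- **RUNG / WITNESS OF THE MECHANISM — LANDED** (p601033, `Theorems/NewtonFramesCappedSlopeSum.lean`, val-width-5904-lc1 g0, explicit
`C = 5`: per-line residue count + low/high slope split at `H = ⌊(n+2)^{2/3}⌋`; tight by `farey_parabola_main` p593702): the slope-height
count on the grid, discharged BY NAME (rev 3). [cite: BBFKOTT10, §5] -/
theorem stub_cappedSlopeSumRung : CappedSlopeSum :=
  Summit.ValiantsHypothesis.ValiantsHypothesis.Theorems.NewtonFramesNewtonTauWeak.CappedSlopeSum.stub_cappedSlopeSumRung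

/-- **DECLARED RESIDUAL** (never staffed). [folklore] -/
theorem stub_residualSlope : ResidualSlope := by
  sorry

/-! ### Compositions (kernel-checked, no sorry of their own) -/

/-- `ThreeSetBound` gives the rung, through U2 and the LANDED `SlopeLadderBlocking.stub_blocking` (p578760, by name). -/
theorem beatTwoThirds_of (h : ThreeSetBound) : BeatTwoThirds :=
  Summit.ValiantsHypothesis.ValiantsHypothesis.Theorems.NewtonFramesNewtonTauWeak.SlopeLadderBlocking.stub_blocking
    (benchmarkTransfer h)

/-- The rung from the registered stubs. -/
theorem beatTwoThirds_of_stubs : BeatTwoThirds := beatTwoThirds_of stub_threeSetBound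

/-- **THE LINE CONCLUDES THE CRUX BY NAME**, through the declared residual (exactly as the line of record). -/
theorem NewtonTauWeak_of (h : ThreeSetBound) (hres : ResidualSlope) :
    Summit.ValiantsHypothesis.ValiantsHypothesis.Theses.NewtonFrames.NewtonTauWeak :=
  hres (beatTwoThirds_of h)

/-- Same with every input discharged by its registered stub. -/
theorem NewtonTauWeak_proof : Summit.ValiantsHypothesis.ValiantsHypothesis.Theses.NewtonFrames.NewtonTauWeak :=
  NewtonTauWeak_of stub_threeSetBound stub_residualSlope

end Summit.ValiantsHypothesis.ValiantsHypothesis.Cruxes.NewtonTauWeak.LandingCollapse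

end
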